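import Summits.BirchSwinnertonDyer.BirchSwinnertonDyer.Theorems.AlignedTransportAtTwoMainConjectureTransportAlignedAtTwoKilfordCopyCrossLevelFactorConductor
import Summits.BirchSwinnertonDyer.BirchSwinnertonDyer.Theorems.AlignedTransportAtTwoMainConjectureTransportAlignedAtTwoKilfordCopyCrossLevelFactorHecke
import Summits.BirchSwinnertonDyer.BirchSwinnertonDyer.Theorems.AlignedTransportAtTwoMainConjectureTransportAlignedAtTwoSharedCubicTorsion
import Summits.BirchSwinnertonDyer.BirchSwinnertonDyer.Theorems.AlignedTransportAtTwoMainConjectureTransportAlignedAtTwoKilfordCopyCrossLevelOldLineForm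
import HarnessLib

/-!
# Crux C1 `MainConjectureTransportAlignedAtTwo` (stmt-BirchSwinnertonDyer-22296), line `birth`, residual (R2) `stub_lamLawKilford`, UNEQUAL conductors —
# THE COMMON MOD-2 EIGEN-IDEAL AT `lcm(N₁, N₂)` KILLS THE HALF-PERIODS OF BOTH CANONICAL OLD FORMS: «`θ₁, θ₂` kill `𝔪·J₀(L)[2]`» with ONE
# `𝔪 = (2, T_p − a_p(W₁) (p ∤ N₁N₂), T_ℓ − β_ℓ (ℓ ∈ S))` (width seat att-p3 g19; `--supports 22296`)

THEOREMS ONLY (no `def`, no `sorry`, no named fact). The Hecke half (row (r3)) of the level-`L` carrier rows for the two maps `θᵢ = Dᵢ.jacobiMapForm L Fᵢ` of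
the cross-level kernel letter (att-p4 g17 `…CrossLevelCommonLevelLetter`, hypotheses `hθUᵢ`), for the CANONICAL generalised old forms `F₁, F₂` of
`…CrossLevelFactorConductor` at `L = lcm(N(W₁), N(W₂))`, EVERY conductor shape: `…CrossLevelFactorHecke.factorForm_half_smul_mem_of_mem_span` instantiated on both
sides with the canonical data (constraints: `…FactorConductor.factorData_spec`), and the two generator sets identified — `a_p(W₁) ≡ a_p(W₂) (mod 2)` off `S`
(shared cubic field at odd good `p`: `…SharedCubicTorsion.even_LFunction_sub_of_sharedCubicField`; both ordinary at `p = 2`), common `β_ℓ = 𝟙[¬ℓ²∣N₁ ∧ ¬ℓ²∣N₂]`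
on `S`. BSD is not proved by this; C1 is not closed by this; the Galois rows ((W1)/(W3) on `J₀(L)[2]`, multiplicity at `(L, 𝔪)`, (W0′), `θᵢ ≠ 0`) are not touched.

* §1 `span_le_span_of_congr` — exchanging the generators `T_p − a₁(p)` ↔ `T_p − a₂(p)` when `a₁(p) ≡ a₂(p) (mod 2)` (`2` is a generator).
* §2 **`canonicalForms_rows`** — for the two canonical forms at `L = lcm`: lattice compatibility `cᵢ·φ(Fᵢ) ∈ Λ(Wᵢ)` (the `hg` of `Dᵢ.jacobiMapForm L Fᵢ`), rational
  `q`-expansions (the T1⁺ binder), and for every `t ∈ 𝔪`, `y ∈ H₁(X₀(L);ℤ)`: `c₁·(t•y)(F₁)/2 ∈ Λ(W₁)` AND `c₂·(t•y)(F₂)/2 ∈ Λ(W₂)`;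
  `canonicalForms_half_smul_mem_of_mem_span` (the last row alone); **`jacobiMapForm_canonicalForms_half_smul_eq_zero`** — the same in T1⁺ currency:
  `Dᵢ.jacobiMapForm L Fᵢ _ [(t•y)/2] = O` for both `i` — VERBATIM the hypotheses `hF₁𝔪`, `hF₂𝔪` of att-p4 g18's shape-agnostic consumer
  `…KilfordKernelLetterCrossLevelCarrierForms.uniformize_twoForms_ker_iff_of_carrier` (p701652) with this `𝔪`.

References: Darmon–Diamond–Taylor 1995 §1.3, §4.1, Prop. 2.11 [DarmonDiamondTaylor1995]; Cremona 1997 §2.4, §2.10 [CremonaAlgorithms1997]; Kraus–Oesterlé 1992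
Prop. 3 [KrausOesterle1992]; Kilford–Wiese 2008 Question 1.9 (reading) [KilfordWiese2008].
-/

noncomputable section

-- justification: the `Summit.BirchSwinnertonDyer.BirchSwinnertonDyer.…` path repeats a component (route-file convention)
set_option linter.dupNamespace false
set_option autoImplicit false

open scoped MatrixGroups ModularForm Classical

open CongruenceSubgroup Complex WeierstrassCurve IsDedekindDomain Polynomial
open Literature.NumberTheory.EllipticCurves Literature.NumberTheory.EllipticCurves.ModularForms
open Literature.NumberTheory.EllipticCurves.Greenberg1999
open Summit.BirchSwinnertonDyer.Rank1Residual.F1Sign2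
open Summit.BirchSwinnertonDyer.BirchSwinnertonDyer.Theorems.AlignedTransportAtTwoKilfordCopyCrossLevelFactorForms (modularSymbol_factorForm)
open Summit.BirchSwinnertonDyer.BirchSwinnertonDyer.Theorems.AlignedTransportAtTwoKilfordCopyCrossLevelFactorHecke (factorForm_half_smul_mem_of_mem_span)
open Summit.BirchSwinnertonDyer.BirchSwinnertonDyer.Theorems.AlignedTransportAtTwoKilfordCopyCrossLevelFactorConductor (factorData_spec factorLevel_dvd)
open Summit.BirchSwinnertonDyer.BirchSwinnertonDyer.Theorems.AlignedTransportAtTwoKilfordCopyLevelRaisingParity (ne_two_of_dvd_conductorNorm_of_isOrdinaryAt)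
open Summit.BirchSwinnertonDyer.BirchSwinnertonDyer.Theorems.AlignedTransportAtTwoSharedCubicTorsion (even_LFunction_sub_of_sharedCubicField)
open Summit.BirchSwinnertonDyer.BirchSwinnertonDyer.Theorems.AlignedTransportAtTwoKilfordCopyCrossLevelFactor (factorForm_mul_apply_mem)
open Summit.BirchSwinnertonDyer.BirchSwinnertonDyer.Theorems.AlignedTransportAtTwoKilfordCopyCrossLevelFactorForms (rat_cuspCoeff_factorForm)
open Summit.BirchSwinnertonDyer.BirchSwinnertonDyer.Theorems.AlignedTransportAtTwoKilfordCopyCrossLevelOldLineForm (jacobiMapForm_oldLine_half_eq_zero_iff)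

namespace Summit.BirchSwinnertonDyer.BirchSwinnertonDyer.Theorems.AlignedTransportAtTwoKilfordCopyCrossLevelFactorHeckeConductor

/-! ## §1 Exchanging congruent generators -/

/-- **Congruent eigenvalue generators span the same ideal with `2`**: if `a₁(p) ≡ a₂(p) (mod 2)` for every `p` in the index predicate, the ideal generated
by `2`, the `T_p − a₁(p)` and a further family `Q` contains the `T_p − a₂(p)`: `T_p − a₂(p) = (T_p − a₁(p)) + (a₁(p) − a₂(p))`. [cite: DarmonDiamondTaylor1995, §4.1] -/
theorem span_le_span_of_congr {L : ℕ} [NeZero L] (P : ℕ → Prop) (A₁ A₂ : ℕ → ℤ) (hA : ∀ p, p.Prime → P p → (2 : ℤ) ∣ A₁ p - A₂ p)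
    (Q : HeckeRing0 L 2 → Prop) :
    Ideal.span ({t : HeckeRing0 L 2 | t = 2 ∨ (∃ (p : ℕ) (hp : p.Prime), P p ∧ t = HeckeRing0.T L 2 p hp - (A₂ p : HeckeRing0 L 2)) ∨ Q t}) ≤
      Ideal.span ({t : HeckeRing0 L 2 | t = 2 ∨ (∃ (p : ℕ) (hp : p.Prime), P p ∧ t = HeckeRing0.T L 2 p hp - (A₁ p : HeckeRing0 L 2)) ∨ Q t}) := by
  refine Ideal.span_le.mpr ?_
  rintro s (rfl | ⟨p, hp, hPp, rfl⟩ | hs)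
  · exact Ideal.subset_span (Or.inl rfl)
  · obtain ⟨k, hk⟩ := hA p hp hPp
    have h : HeckeRing0.T L 2 p hp - (A₂ p : HeckeRing0 L 2) =
        (HeckeRing0.T L 2 p hp - (A₁ p : HeckeRing0 L 2)) + (k : HeckeRing0 L 2) * 2 := by
      have hk' : ((A₁ p : ℤ) : HeckeRing0 L 2) - (A₂ p : HeckeRing0 L 2) = (k : HeckeRing0 L 2) * 2 := by
        rw [← Int.cast_sub, hk]; push_cast; ring
      linear_combination hk'
    rw [SetLike.mem_coe, h]
    exact Ideal.add_mem _ (Ideal.subset_span (Or.inr (Or.inl ⟨p, hp, hPp, rfl⟩))) (Ideal.mul_mem_left _ _ (Ideal.subset_span (Or.inl rfl)))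
  · exact Ideal.subset_span (Or.inr (Or.inr hs))

/-! ## §2 Both canonical old forms are killed by the common eigen-ideal -/

/-- **The common mod-`2` eigen-ideal at `L = lcm(N(W₁), N(W₂))` kills the half-periods of BOTH canonical generalised old forms.** For `W₁, W₂` globally minimal,
good ordinary at `2`, without rational `2`-torsion abscissa, sharing the cubic field `F ∋ e₁, e₂` of their `u`-cubics, parametrisation data `Dᵢ` at the conductors,
`S = primeFactors(N₁N₂) ∖ {2}`, the canonical forms `F₁, F₂ ∈ S₂(Γ₀(L))` (by their `q`-expansions, data of `…FactorConductor`) and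
`𝔪 = (2, T_p − a_p(W₁) (p prime ∉ S), T_ℓ − β_ℓ (ℓ ∈ S))`, `β_ℓ = 𝟙[¬ℓ²∣N₁ ∧ ¬ℓ²∣N₂]`: for every `t ∈ 𝔪` and `y ∈ H₁(X₀(L);ℤ)`,
`c₁·(t•y)(F₁)/2 ∈ Λ(W₁)` and `c₂·(t•y)(F₂)/2 ∈ Λ(W₂)`. [cite: DarmonDiamondTaylor1995, §1.3, §4.1 and Prop. 2.11 (a)] [cite: CremonaAlgorithms1997, §2.4 and §2.10]
[cite: KrausOesterle1992, Prop. 3 (p. 262–263)] -/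
theorem canonicalForms_rows
    (W₁ W₂ : WeierstrassCurve ℚ) [W₁.IsElliptic] [W₁.IsGloballyMinimal] [W₂.IsElliptic] [W₂.IsGloballyMinimal]
    (hord₁ : IsOrdinaryAt W₁ 2) (hord₂ : IsOrdinaryAt W₂ 2)
    {F : Type*} [Field F] [NumberField F] (hF : Module.finrank ℚ F = 3)
    (ht₁ : ∀ x : ℚ, ¬ HasRationalTwoTorsionX W₁ x) (ht₂ : ∀ x : ℚ, ¬ HasRationalTwoTorsionX W₂ x)
    {e₁ e₂ : F} (he₁ : aeval e₁ (twoDivisionUCubic W₁) = 0) (he₂ : aeval e₂ (twoDivisionUCubic W₂) = 0)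
    [NeZero (W₁.conductorNorm ℤ)] [NeZero (W₂.conductorNorm ℤ)]
    (D₁ : ModularParametrizationData W₁ (W₁.conductorNorm ℤ)) (D₂ : ModularParametrizationData W₂ (W₂.conductorNorm ℤ))
    (L : ℕ) [NeZero L] (hLdef : L = Nat.lcm (W₁.conductorNorm ℤ) (W₂.conductorNorm ℤ))
    (F₁ F₂ : CuspForm (Gamma0 L) 2)
    (hF₁ : ∀ n : ℕ, cuspCoeff F₁ n =
          ((∏ ℓ ∈ (W₁.conductorNorm ℤ * W₂.conductorNorm ℤ).primeFactors.erase 2,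
            (MonoidAlgebra.single 1 (1 : ℂ) + MonoidAlgebra.single ℓ ((if ((¬ ℓ ∣ W₁.conductorNorm ℤ ∧ ℓ ∣ W₂.conductorNorm ℤ ∧ (¬ ℓ ^ 2 ∣ W₂.conductorNorm ℤ ∨ Odd (W₁.LFunction ℓ))) ∨ (ℓ ∣ W₁.conductorNorm ℤ ∧ ¬ ℓ ^ 2 ∣ W₁.conductorNorm ℤ ∧ ℓ ^ 2 ∣ W₂.conductorNorm ℤ)) then (1 : ℤ) else 0 : ℤ) : ℂ) +
              MonoidAlgebra.single (ℓ ^ 2) ((if (¬ ℓ ∣ W₁.conductorNorm ℤ ∧ ℓ ^ 2 ∣ W₂.conductorNorm ℤ) then (1 : ℤ) else 0 : ℤ) : ℂ)) : MonoidAlgebra ℂ ℕ).coeff.sum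
            fun m c ↦ c * ((m : ℂ) * if m ∣ n then cuspCoeff D₁.f (n / m) else 0)))
    (hF₂ : ∀ n : ℕ, cuspCoeff F₂ n =
          ((∏ ℓ ∈ (W₁.conductorNorm ℤ * W₂.conductorNorm ℤ).primeFactors.erase 2,
            (MonoidAlgebra.single 1 (1 : ℂ) + MonoidAlgebra.single ℓ ((if ((¬ ℓ ∣ W₂.conductorNorm ℤ ∧ ℓ ∣ W₁.conductorNorm ℤ ∧ (¬ ℓ ^ 2 ∣ W₁.conductorNorm ℤ ∨ Odd (W₂.LFunction ℓ))) ∨ (ℓ ∣ W₂.conductorNorm ℤ ∧ ¬ ℓ ^ 2 ∣ W₂.conductorNorm ℤ ∧ ℓ ^ 2 ∣ W₁.conductorNorm ℤ)) then (1 : ℤ) else 0 : ℤ) : ℂ) +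
              MonoidAlgebra.single (ℓ ^ 2) ((if (¬ ℓ ∣ W₂.conductorNorm ℤ ∧ ℓ ^ 2 ∣ W₁.conductorNorm ℤ) then (1 : ℤ) else 0 : ℤ) : ℂ)) : MonoidAlgebra ℂ ℕ).coeff.sum
            fun m c ↦ c * ((m : ℂ) * if m ∣ n then cuspCoeff D₂.f (n / m) else 0)))
    :
    (∀ φ ∈ periodHomology L, (D₁.c : ℂ) * φ F₁ ∈ D₁.L.lattice) ∧ (∀ φ ∈ periodHomology L, (D₂.c : ℂ) * φ F₂ ∈ D₂.L.lattice) ∧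
    (∀ n : ℕ, ∃ q : ℚ, cuspCoeff F₁ n = q) ∧ (∀ n : ℕ, ∃ q : ℚ, cuspCoeff F₂ n = q) ∧
    ∀ t : HeckeRing0 L 2, t ∈ Ideal.span ({t : HeckeRing0 L 2 | t = 2 ∨
      (∃ (p : ℕ) (hp : p.Prime), p ∉ (W₁.conductorNorm ℤ * W₂.conductorNorm ℤ).primeFactors.erase 2 ∧ t = HeckeRing0.T L 2 p hp - (W₁.LFunction p : HeckeRing0 L 2)) ∨
      (∃ (ℓ : ℕ) (hℓ : ℓ ∈ (W₁.conductorNorm ℤ * W₂.conductorNorm ℤ).primeFactors.erase 2),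
        t = HeckeRing0.T L 2 ℓ (Nat.prime_of_mem_primeFactors (Finset.mem_of_mem_erase hℓ)) -
          ((if (¬ ℓ ^ 2 ∣ W₁.conductorNorm ℤ ∧ ¬ ℓ ^ 2 ∣ W₂.conductorNorm ℤ) then (1 : ℤ) else 0 : ℤ) : HeckeRing0 L 2))}) →
    ∀ y : periodHomologyHecke L,
      (D₁.c : ℂ) * ((t • y : periodHomologyHecke L) : Module.Dual ℂ (CuspForm (Gamma0 L) 2)) F₁ / 2 ∈ D₁.L.lattice ∧
      (D₂.c : ℂ) * ((t • y : periodHomologyHecke L) : Module.Dual ℂ (CuspForm (Gamma0 L) 2)) F₂ / 2 ∈ D₂.L.lattice := by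
  classical
  set S : Finset ℕ := (W₁.conductorNorm ℤ * W₂.conductorNorm ℤ).primeFactors.erase 2 with hSdef
  have hN₁ : W₁.conductorNorm ℤ ≠ 0 := NeZero.ne _
  have hN₂ : W₂.conductorNorm ℤ ≠ 0 := NeZero.ne _
  have hS : ∀ ℓ ∈ S, ℓ.Prime := fun ℓ hℓ ↦ Nat.prime_of_mem_primeFactors (Finset.mem_of_mem_erase hℓ)
  have hS0 : ∀ ℓ ∈ S, ℓ ≠ 0 := fun ℓ hℓ ↦ (hS ℓ hℓ).ne_zero
  have hS2 : ∀ ℓ ∈ S, ℓ ≠ 2 := fun ℓ hℓ ↦ Finset.ne_of_mem_erase hℓ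
  have hSodd : ∀ ℓ ∈ S, Odd ℓ := fun ℓ hℓ ↦ (hS ℓ hℓ).odd_of_ne_two (hS2 ℓ hℓ)
  have hSN : ∀ ℓ ∈ S, ℓ ∣ W₁.conductorNorm ℤ ∨ ℓ ∣ W₂.conductorNorm ℤ := fun ℓ hℓ ↦
    (Nat.Prime.dvd_mul (hS ℓ hℓ)).mp (Nat.dvd_of_mem_primeFactors (Finset.mem_of_mem_erase hℓ))
  have hSL : ∀ ℓ ∈ S, ℓ ∣ L := fun ℓ hℓ ↦ by
    rw [hLdef]; exact (hSN ℓ hℓ).elim (fun h ↦ h.trans (Nat.dvd_lcm_left _ _)) (fun h ↦ h.trans (Nat.dvd_lcm_right _ _))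
  have hLS : ∀ p : ℕ, p.Prime → p ∣ L → p ∈ S := by
    intro p hp hpL
    have hpNN : p ∣ W₁.conductorNorm ℤ * W₂.conductorNorm ℤ := by rw [hLdef] at hpL; exact hpL.trans (Nat.lcm_dvd_mul _ _)
    refine Finset.mem_erase.mpr ⟨?_, Nat.mem_primeFactors.mpr ⟨hp, hpNN, mul_ne_zero hN₁ hN₂⟩⟩
    rcases (Nat.Prime.dvd_mul hp).mp hpNN with h | h
    · exact ne_two_of_dvd_conductorNorm_of_isOrdinaryAt W₁ hord₁ h
    · exact ne_two_of_dvd_conductorNorm_of_isOrdinaryAt W₂ hord₂ h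
  -- congruence of the eigenvalues off `S`
  have hcongr : ∀ p, p.Prime → p ∉ S → (2 : ℤ) ∣ W₁.LFunction p - W₂.LFunction p := by
    intro p hp hpS
    have hpL : ¬ p ∣ L := fun h ↦ hpS (hLS p hp h)
    have hp₁ : ¬ p ∣ W₁.conductorNorm ℤ := fun h ↦ hpL (by rw [hLdef]; exact h.trans (Nat.dvd_lcm_left _ _))
    have hp₂ : ¬ p ∣ W₂.conductorNorm ℤ := fun h ↦ hpL (by rw [hLdef]; exact h.trans (Nat.dvd_lcm_right _ _))
    by_cases hp2 : p = 2
    · subst hp2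
      rw [LFunction_apply_prime_eq_frobeniusTrace W₁ 2 hord₁.1, LFunction_apply_prime_eq_frobeniusTrace W₂ 2 hord₂.1]
      have h₁ := hord₁.2
      have h₂ := hord₂.2
      push_cast at h₁ h₂
      omega
    · exact (even_LFunction_sub_of_sharedCubicField W₁ W₂ hF ht₁ ht₂ he₁ he₂ hp hp2 hp₁ hp₂).two_dvd
  -- the constraints, prime by prime
  have spec := fun (ℓ : ℕ) (hℓ : ℓ ∈ S) ↦ factorData_spec W₁ W₂ hF ht₁ ht₂ he₁ he₂ (hS ℓ hℓ) (hS2 ℓ hℓ) (hSN ℓ hℓ)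
    ((fun ℓ ↦ if (¬ ℓ ^ 2 ∣ W₁.conductorNorm ℤ ∧ ¬ ℓ ^ 2 ∣ W₂.conductorNorm ℤ) then (1 : ℤ) else 0) ℓ) ((fun ℓ ↦ if ((¬ ℓ ∣ W₁.conductorNorm ℤ ∧ ℓ ∣ W₂.conductorNorm ℤ ∧ (¬ ℓ ^ 2 ∣ W₂.conductorNorm ℤ ∨ Odd (W₁.LFunction ℓ))) ∨ (ℓ ∣ W₁.conductorNorm ℤ ∧ ¬ ℓ ^ 2 ∣ W₁.conductorNorm ℤ ∧ ℓ ^ 2 ∣ W₂.conductorNorm ℤ)) then (1 : ℤ) else 0) ℓ) ((fun ℓ ↦ if (¬ ℓ ∣ W₁.conductorNorm ℤ ∧ ℓ ^ 2 ∣ W₂.conductorNorm ℤ) then (1 : ℤ) else 0) ℓ) ((fun ℓ ↦ if ((¬ ℓ ∣ W₂.conductorNorm ℤ ∧ ℓ ∣ W₁.conductorNorm ℤ ∧ (¬ ℓ ^ 2 ∣ W₁.conductorNorm ℤ ∨ Odd (W₂.LFunction ℓ))) ∨ (ℓ ∣ W₂.conductorNorm ℤ ∧ ¬ ℓ ^ 2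 ∣ W₂.conductorNorm ℤ ∧ ℓ ^ 2 ∣ W₁.conductorNorm ℤ)) then (1 : ℤ) else 0) ℓ) ((fun ℓ ↦ if (¬ ℓ ∣ W₂.conductorNorm ℤ ∧ ℓ ^ 2 ∣ W₁.conductorNorm ℤ) then (1 : ℤ) else 0) ℓ)
    (fun h ↦ if_pos h) (fun h ↦ if_neg h) (fun h ↦ if_pos h) (fun h ↦ if_neg h) (fun h ↦ if_pos h) (fun h ↦ if_neg h)
    (fun h ↦ if_pos h) (fun h ↦ if_neg h) (fun h ↦ if_pos h) (fun h ↦ if_neg h)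
  have hρe₁ : ∀ ℓ ∈ S, (fun ℓ ↦ if (¬ ℓ ∣ W₁.conductorNorm ℤ ∧ ℓ ^ 2 ∣ W₂.conductorNorm ℤ) then 2 else if ((¬ ℓ ∣ W₁.conductorNorm ℤ ∧ ℓ ∣ W₂.conductorNorm ℤ ∧ (¬ ℓ ^ 2 ∣ W₂.conductorNorm ℤ ∨ Odd (W₁.LFunction ℓ))) ∨ (ℓ ∣ W₁.conductorNorm ℤ ∧ ¬ ℓ ^ 2 ∣ W₁.conductorNorm ℤ ∧ ℓ ^ 2 ∣ W₂.conductorNorm ℤ)) then 1 else 0) ℓ = 0 → (fun ℓ ↦ if ((¬ ℓ ∣ W₁.conductorNorm ℤ ∧ ℓ ∣ W₂.conductorNorm ℤ ∧ (¬ ℓ ^ 2 ∣ W₂.conductorNorm ℤ ∨ Odd (W₁.LFunction ℓ))) ∨ (ℓ ∣ W₁.conductorNorm ℤ ∧ ¬ ℓ ^ 2 ∣ W₁.conductorNorm ℤ ∧ ℓ ^ 2 ∣ W₂.conductorNorm ℤ)) then (1 : ℤ) else 0) ℓ = 0 := by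
    intro ℓ _ h
    dsimp only at h ⊢
    split_ifs at h with h1 h2
    all_goals omega
  have hσe₁ : ∀ ℓ ∈ S, (fun ℓ ↦ if (¬ ℓ ∣ W₁.conductorNorm ℤ ∧ ℓ ^ 2 ∣ W₂.conductorNorm ℤ) then 2 else if ((¬ ℓ ∣ W₁.conductorNorm ℤ ∧ ℓ ∣ W₂.conductorNorm ℤ ∧ (¬ ℓ ^ 2 ∣ W₂.conductorNorm ℤ ∨ Odd (W₁.LFunction ℓ))) ∨ (ℓ ∣ W₁.conductorNorm ℤ ∧ ¬ ℓ ^ 2 ∣ W₁.conductorNorm ℤ ∧ ℓ ^ 2 ∣ W₂.conductorNorm ℤ)) then 1 else 0) ℓ ≤ 1 → (fun ℓ ↦ if (¬ ℓ ∣ W₁.conductorNorm ℤ ∧ ℓ ^ 2 ∣ W₂.conductorNorm ℤ) then (1 : ℤ) else 0) ℓ = 0 := by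
    intro ℓ _ h
    dsimp only at h ⊢
    split_ifs at h with h1 h2
    all_goals omega
  have hρe₂ : ∀ ℓ ∈ S, (fun ℓ ↦ if (¬ ℓ ∣ W₂.conductorNorm ℤ ∧ ℓ ^ 2 ∣ W₁.conductorNorm ℤ) then 2 else if ((¬ ℓ ∣ W₂.conductorNorm ℤ ∧ ℓ ∣ W₁.conductorNorm ℤ ∧ (¬ ℓ ^ 2 ∣ W₁.conductorNorm ℤ ∨ Odd (W₂.LFunction ℓ))) ∨ (ℓ ∣ W₂.conductorNorm ℤ ∧ ¬ ℓ ^ 2 ∣ W₂.conductorNorm ℤ ∧ ℓ ^ 2 ∣ W₁.conductorNorm ℤ)) then 1 else 0) ℓ = 0 → (fun ℓ ↦ if ((¬ ℓ ∣ W₂.conductorNorm ℤ ∧ ℓ ∣ W₁.conductorNorm ℤ ∧ (¬ ℓ ^ 2 ∣ W₁.conductorNorm ℤ ∨ Odd (W₂.LFunction ℓ))) ∨ (ℓ ∣ W₂.conductorNorm ℤ ∧ ¬ ℓ ^ 2 ∣ W₂.conductorNorm ℤ ∧ ℓ ^ 2 ∣ W₁.conductorNorm ℤ)) then (1 : ℤ)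 else 0) ℓ = 0 := by
    intro ℓ _ h
    dsimp only at h ⊢
    split_ifs at h with h1 h2
    all_goals omega
  have hσe₂ : ∀ ℓ ∈ S, (fun ℓ ↦ if (¬ ℓ ∣ W₂.conductorNorm ℤ ∧ ℓ ^ 2 ∣ W₁.conductorNorm ℤ) then 2 else if ((¬ ℓ ∣ W₂.conductorNorm ℤ ∧ ℓ ∣ W₁.conductorNorm ℤ ∧ (¬ ℓ ^ 2 ∣ W₁.conductorNorm ℤ ∨ Odd (W₂.LFunction ℓ))) ∨ (ℓ ∣ W₂.conductorNorm ℤ ∧ ¬ ℓ ^ 2 ∣ W₂.conductorNorm ℤ ∧ ℓ ^ 2 ∣ W₁.conductorNorm ℤ)) then 1 else 0) ℓ ≤ 1 → (fun ℓ ↦ if (¬ ℓ ∣ W₂.conductorNorm ℤ ∧ ℓ ^ 2 ∣ W₁.conductorNorm ℤ) then (1 : ℤ) else 0) ℓ = 0 := by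
    intro ℓ _ h
    dsimp only at h ⊢
    split_ifs at h with h1 h2
    all_goals omega
  have hL₁ : W₁.conductorNorm ℤ * ∏ ℓ ∈ S, ℓ ^ (fun ℓ ↦ if (¬ ℓ ∣ W₁.conductorNorm ℤ ∧ ℓ ^ 2 ∣ W₂.conductorNorm ℤ) then 2 else if ((¬ ℓ ∣ W₁.conductorNorm ℤ ∧ ℓ ∣ W₂.conductorNorm ℤ ∧ (¬ ℓ ^ 2 ∣ W₂.conductorNorm ℤ ∨ Odd (W₁.LFunction ℓ))) ∨ (ℓ ∣ W₁.conductorNorm ℤ ∧ ¬ ℓ ^ 2 ∣ W₁.conductorNorm ℤ ∧ ℓ ^ 2 ∣ W₂.conductorNorm ℤ)) then 1 else 0) ℓ ∣ L := by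
    rw [hLdef]
    refine factorLevel_dvd _ _ hN₁ hN₂ S hS _ fun ℓ hℓ ↦ ?_
    split_ifs with h1 h2
    · exact Or.inr (Or.inr ⟨rfl, h1.1, h1.2⟩)
    · refine Or.inr (Or.inl ⟨rfl, ?_⟩)
      rcases h2 with h2 | h2
      · exact Or.inl ⟨h2.1, h2.2.1⟩
      · exact Or.inr h2
    · exact Or.inl rfl
  have hL₂ : W₂.conductorNorm ℤ * ∏ ℓ ∈ S, ℓ ^ (fun ℓ ↦ if (¬ ℓ ∣ W₂.conductorNorm ℤ ∧ ℓ ^ 2 ∣ W₁.conductorNorm ℤ) then 2 else if ((¬ ℓ ∣ W₂.conductorNorm ℤ ∧ ℓ ∣ W₁.conductorNorm ℤ ∧ (¬ ℓ ^ 2 ∣ W₁.conductorNorm ℤ ∨ Odd (W₂.LFunction ℓ))) ∨ (ℓ ∣ W₂.conductorNorm ℤ ∧ ¬ ℓ ^ 2 ∣ W₂.conductorNorm ℤ ∧ ℓ ^ 2 ∣ W₁.conductorNorm ℤ)) then 1 else 0) ℓ ∣ L := by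
    rw [hLdef, Nat.lcm_comm]
    refine factorLevel_dvd _ _ hN₂ hN₁ S hS _ fun ℓ hℓ ↦ ?_
    split_ifs with h1 h2
    · exact Or.inr (Or.inr ⟨rfl, h1.1, h1.2⟩)
    · refine Or.inr (Or.inl ⟨rfl, ?_⟩)
      rcases h2 with h2 | h2
      · exact Or.inl ⟨h2.1, h2.2.1⟩
      · exact Or.inr h2
    · exact Or.inl rfl
  -- the symbol identities of the two canonical forms
  have hF₁sym := modularSymbol_factorForm D₁.f _ D₁.isNewformOf.2 (fun ℓ ↦ if ((¬ ℓ ∣ W₁.conductorNorm ℤ ∧ ℓ ∣ W₂.conductorNorm ℤ ∧ (¬ ℓ ^ 2 ∣ W₂.conductorNorm ℤ ∨ Odd (W₁.LFunction ℓ))) ∨ (ℓ ∣ W₁.conductorNorm ℤ ∧ ¬ ℓ ^ 2 ∣ W₁.conductorNorm ℤ ∧ ℓ ^ 2 ∣ W₂.conductorNorm ℤ)) then (1 : ℤ) else 0) (fun ℓ ↦ if (¬ ℓ ∣ W₁.conductorNorm ℤ ∧ ℓ ^ 2 ∣ W₂.conductorNorm ℤ) then (1 : ℤ) else 0) (fun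 ℓ ↦ if (¬ ℓ ∣ W₁.conductorNorm ℤ ∧ ℓ ^ 2 ∣ W₂.conductorNorm ℤ) then 2 else if ((¬ ℓ ∣ W₁.conductorNorm ℤ ∧ ℓ ∣ W₂.conductorNorm ℤ ∧ (¬ ℓ ^ 2 ∣ W₂.conductorNorm ℤ ∨ Odd (W₁.LFunction ℓ))) ∨ (ℓ ∣ W₁.conductorNorm ℤ ∧ ¬ ℓ ^ 2 ∣ W₁.conductorNorm ℤ ∧ ℓ ^ 2 ∣ W₂.conductorNorm ℤ)) then 1 else 0) S hS0 hρe₁ hσe₁ hL₁ F₁ hF₁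
  have hF₂sym := modularSymbol_factorForm D₂.f _ D₂.isNewformOf.2 (fun ℓ ↦ if ((¬ ℓ ∣ W₂.conductorNorm ℤ ∧ ℓ ∣ W₁.conductorNorm ℤ ∧ (¬ ℓ ^ 2 ∣ W₁.conductorNorm ℤ ∨ Odd (W₂.LFunction ℓ))) ∨ (ℓ ∣ W₂.conductorNorm ℤ ∧ ¬ ℓ ^ 2 ∣ W₂.conductorNorm ℤ ∧ ℓ ^ 2 ∣ W₁.conductorNorm ℤ)) then (1 : ℤ) else 0) (fun ℓ ↦ if (¬ ℓ ∣ W₂.conductorNorm ℤ ∧ ℓ ^ 2 ∣ W₁.conductorNorm ℤ) then (1 : ℤ) else 0) (fun ℓ ↦ if (¬ ℓ ∣ W₂.conductorNorm ℤ ∧ ℓ ^ 2 ∣ W₁.conductorNorm ℤ) then 2 else if ((¬ ℓ ∣ W₂.conductorNorm ℤ ∧ ℓ ∣ W₁.conductorNorm ℤ ∧ (¬ ℓ ^ 2 ∣ W₁.conductorNorm ℤ ∨ Odd (W₂.LFunction ℓ))) ∨ (ℓ ∣ W₂.conductorNorm ℤ ∧ ¬ ℓ ^ 2 ∣ W₂.conductorNorm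 ℤ ∧ ℓ ^ 2 ∣ W₁.conductorNorm ℤ)) then 1 else 0) S hS0 hρe₂ hσe₂ hL₂ F₂ hF₂
  have hT₁ : ∀ (p : ℕ) (hp : p.Prime), (haveI : NeZero p := ⟨hp.ne_zero⟩; heckeT (Gamma0 (W₁.conductorNorm ℤ)) 2 p D₁.f) = cuspCoeff D₁.f p • D₁.f :=
    fun p hp ↦ by haveI : NeZero p := ⟨hp.ne_zero⟩; exact D₁.isNewformOf.1.heckeT_eq_coeff_smul hp
  have hT₂ : ∀ (p : ℕ) (hp : p.Prime), (haveI : NeZero p := ⟨hp.ne_zero⟩; heckeT (Gamma0 (W₂.conductorNorm ℤ)) 2 p D₂.f) = cuspCoeff D₂.f p • D₂.f :=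
    fun p hp ↦ by haveI : NeZero p := ⟨hp.ne_zero⟩; exact D₂.isNewformOf.1.heckeT_eq_coeff_smul hp
  refine ⟨fun φ hφ ↦ factorForm_mul_apply_mem D₁.f (fun ℓ ↦ if ((¬ ℓ ∣ W₁.conductorNorm ℤ ∧ ℓ ∣ W₂.conductorNorm ℤ ∧ (¬ ℓ ^ 2 ∣ W₂.conductorNorm ℤ ∨ Odd (W₁.LFunction ℓ))) ∨ (ℓ ∣ W₁.conductorNorm ℤ ∧ ¬ ℓ ^ 2 ∣ W₁.conductorNorm ℤ ∧ ℓ ^ 2 ∣ W₂.conductorNorm ℤ)) then (1 : ℤ) else 0) (fun ℓ ↦ if (¬ ℓ ∣ W₁.conductorNorm ℤ ∧ ℓ ^ 2 ∣ W₂.conductorNorm ℤ) then (1 : ℤ) else 0) (fun ℓ ↦ if (¬ ℓ ∣ W₁.conductorNorm ℤ ∧ ℓ ^ 2 ∣ W₂.conductorNorm ℤ) then 2 else if ((¬ ℓ ∣ W₁.conductorNorm ℤ ∧ ℓ ∣ W₂.conductorNorm ℤ ∧ (¬ ℓ ^ 2 ∣ W₂.conductorNorm ℤ ∨ Odd (W₁.LFunction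 ℓ))) ∨ (ℓ ∣ W₁.conductorNorm ℤ ∧ ¬ ℓ ^ 2 ∣ W₁.conductorNorm ℤ ∧ ℓ ^ 2 ∣ W₂.conductorNorm ℤ)) then 1 else 0) S hS0 hρe₁ hσe₁ hL₁ F₁ hF₁sym D₁.L.lattice.toAddSubgroup D₁.c
      (fun z hz ↦ D₁.smul_periodLattice_le z hz) φ hφ,
    fun φ hφ ↦ factorForm_mul_apply_mem D₂.f (fun ℓ ↦ if ((¬ ℓ ∣ W₂.conductorNorm ℤ ∧ ℓ ∣ W₁.conductorNorm ℤ ∧ (¬ ℓ ^ 2 ∣ W₁.conductorNorm ℤ ∨ Odd (W₂.LFunction ℓ))) ∨ (ℓ ∣ W₂.conductorNorm ℤ ∧ ¬ ℓ ^ 2 ∣ W₂.conductorNorm ℤ ∧ ℓ ^ 2 ∣ W₁.conductorNorm ℤ)) then (1 : ℤ) else 0) (fun ℓ ↦ if (¬ ℓ ∣ W₂.conductorNorm ℤ ∧ ℓ ^ 2 ∣ W₁.conductorNorm ℤ) then (1 : ℤ) else 0) (fun ℓ ↦ if (¬ ℓ ∣ W₂.conductorNorm ℤ ∧ ℓ ^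 2 ∣ W₁.conductorNorm ℤ) then 2 else if ((¬ ℓ ∣ W₂.conductorNorm ℤ ∧ ℓ ∣ W₁.conductorNorm ℤ ∧ (¬ ℓ ^ 2 ∣ W₁.conductorNorm ℤ ∨ Odd (W₂.LFunction ℓ))) ∨ (ℓ ∣ W₂.conductorNorm ℤ ∧ ¬ ℓ ^ 2 ∣ W₂.conductorNorm ℤ ∧ ℓ ^ 2 ∣ W₁.conductorNorm ℤ)) then 1 else 0) S hS0 hρe₂ hσe₂ hL₂ F₂ hF₂sym D₂.L.lattice.toAddSubgroup D₂.c
      (fun z hz ↦ D₂.smul_periodLattice_le z hz) φ hφ,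
    rat_cuspCoeff_factorForm D₁.f _ D₁.isNewformOf.2 (fun ℓ ↦ if ((¬ ℓ ∣ W₁.conductorNorm ℤ ∧ ℓ ∣ W₂.conductorNorm ℤ ∧ (¬ ℓ ^ 2 ∣ W₂.conductorNorm ℤ ∨ Odd (W₁.LFunction ℓ))) ∨ (ℓ ∣ W₁.conductorNorm ℤ ∧ ¬ ℓ ^ 2 ∣ W₁.conductorNorm ℤ ∧ ℓ ^ 2 ∣ W₂.conductorNorm ℤ)) then (1 : ℤ) else 0) (fun ℓ ↦ if (¬ ℓ ∣ W₁.conductorNorm ℤ ∧ ℓ ^ 2 ∣ W₂.conductorNorm ℤ) then (1 : ℤ) else 0) (fun ℓ ↦ if (¬ ℓ ∣ W₁.conductorNorm ℤ ∧ ℓ ^ 2 ∣ W₂.conductorNorm ℤ) then 2 else if ((¬ ℓ ∣ W₁.conductorNorm ℤ ∧ ℓ ∣ W₂.conductorNorm ℤ ∧ (¬ ℓ ^ 2 ∣ W₂.conductorNorm ℤ ∨ Odd (W₁.LFunction ℓ))) ∨ (ℓ ∣ W₁.conductorNorm ℤ ∧ ¬ ℓ ^ 2 ∣ W₁.conductorNorm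 ℤ ∧ ℓ ^ 2 ∣ W₂.conductorNorm ℤ)) then 1 else 0) S hS0 hρe₁ hσe₁ hL₁ F₁ hF₁,
    rat_cuspCoeff_factorForm D₂.f _ D₂.isNewformOf.2 (fun ℓ ↦ if ((¬ ℓ ∣ W₂.conductorNorm ℤ ∧ ℓ ∣ W₁.conductorNorm ℤ ∧ (¬ ℓ ^ 2 ∣ W₁.conductorNorm ℤ ∨ Odd (W₂.LFunction ℓ))) ∨ (ℓ ∣ W₂.conductorNorm ℤ ∧ ¬ ℓ ^ 2 ∣ W₂.conductorNorm ℤ ∧ ℓ ^ 2 ∣ W₁.conductorNorm ℤ)) then (1 : ℤ) else 0) (fun ℓ ↦ if (¬ ℓ ∣ W₂.conductorNorm ℤ ∧ ℓ ^ 2 ∣ W₁.conductorNorm ℤ) then (1 : ℤ) else 0) (fun ℓ ↦ if (¬ ℓ ∣ W₂.conductorNorm ℤ ∧ ℓ ^ 2 ∣ W₁.conductorNorm ℤ) then 2 else if ((¬ ℓ ∣ W₂.conductorNorm ℤ ∧ ℓ ∣ W₁.conductorNorm ℤ ∧ (¬ ℓ ^ 2 ∣ W₁.conductorNorm ℤ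 ∨ Odd (W₂.LFunction ℓ))) ∨ (ℓ ∣ W₂.conductorNorm ℤ ∧ ¬ ℓ ^ 2 ∣ W₂.conductorNorm ℤ ∧ ℓ ^ 2 ∣ W₁.conductorNorm ℤ)) then 1 else 0) S hS0 hρe₂ hσe₂ hL₂ F₂ hF₂, fun t ht y ↦ ⟨?_, ?_⟩⟩
  · -- side 1: the generators are literally those of `factorForm_half_smul_mem_of_mem_span`
    exact factorForm_half_smul_mem_of_mem_span D₁.f (fun n ↦ W₁.LFunction n) D₁.isNewformOf.2 hT₁ (fun ℓ ↦ if ((¬ ℓ ∣ W₁.conductorNorm ℤ ∧ ℓ ∣ W₂.conductorNorm ℤ ∧ (¬ ℓ ^ 2 ∣ W₂.conductorNorm ℤ ∨ Odd (W₁.LFunction ℓ))) ∨ (ℓ ∣ W₁.conductorNorm ℤ ∧ ¬ ℓ ^ 2 ∣ W₁.conductorNorm ℤ ∧ ℓ ^ 2 ∣ W₂.conductorNorm ℤ)) then (1 : ℤ) else 0) (fun ℓ ↦ if (¬ ℓ ∣ W₁.conductorNorm ℤ ∧ ℓ ^ 2 ∣ W₂.conductorNorm ℤ) then (1 : ℤ)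 else 0) (fun ℓ ↦ if (¬ ℓ ∣ W₁.conductorNorm ℤ ∧ ℓ ^ 2 ∣ W₂.conductorNorm ℤ) then 2 else if ((¬ ℓ ∣ W₁.conductorNorm ℤ ∧ ℓ ∣ W₂.conductorNorm ℤ ∧ (¬ ℓ ^ 2 ∣ W₂.conductorNorm ℤ ∨ Odd (W₁.LFunction ℓ))) ∨ (ℓ ∣ W₁.conductorNorm ℤ ∧ ¬ ℓ ^ 2 ∣ W₁.conductorNorm ℤ ∧ ℓ ^ 2 ∣ W₂.conductorNorm ℤ)) then 1 else 0) S hS hSodd hρe₁ hσe₁ hL₁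
      hSL hLS F₁ hF₁sym D₁.L.lattice.toAddSubgroup D₁.c (fun z hz ↦ D₁.smul_periodLattice_le z hz) (fun ℓ ↦ if (¬ ℓ ^ 2 ∣ W₁.conductorNorm ℤ ∧ ¬ ℓ ^ 2 ∣ W₂.conductorNorm ℤ) then (1 : ℤ) else 0)
      (fun ℓ hℓ ↦ by have h := (spec ℓ hℓ).1.1; rwa [zero_mul, add_zero] at h) (fun ℓ hℓ ↦ (spec ℓ hℓ).1.2.1)
      (fun ℓ hℓ ↦ by have h := (spec ℓ hℓ).1.2.2; rwa [zero_add] at h) ht y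
  · -- side 2: exchange the generators `T_p − a_p(W₁)` for `T_p − a_p(W₂)`
    have ht₂ := span_le_span_of_congr (fun p ↦ p ∉ S) (fun n ↦ W₂.LFunction n) (fun n ↦ W₁.LFunction n)
      (fun p hp hpS ↦ by rw [← neg_sub]; exact (hcongr p hp hpS).neg_right) _ ht
    exact factorForm_half_smul_mem_of_mem_span D₂.f (fun n ↦ W₂.LFunction n) D₂.isNewformOf.2 hT₂ (fun ℓ ↦ if ((¬ ℓ ∣ W₂.conductorNorm ℤ ∧ ℓ ∣ W₁.conductorNorm ℤ ∧ (¬ ℓ ^ 2 ∣ W₁.conductorNorm ℤ ∨ Odd (W₂.LFunction ℓ))) ∨ (ℓ ∣ W₂.conductorNorm ℤ ∧ ¬ ℓ ^ 2 ∣ W₂.conductorNorm ℤ ∧ ℓ ^ 2 ∣ W₁.conductorNorm ℤ)) then (1 : ℤ) else 0) (fun ℓ ↦ if (¬ ℓ ∣ W₂.conductorNorm ℤ ∧ ℓ ^ 2 ∣ W₁.conductorNorm ℤ) then (1 : ℤ) else 0) (fun ℓ ↦ if (¬ ℓ ∣ W₂.conductorNorm ℤ ∧ ℓ ^ 2 ∣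 W₁.conductorNorm ℤ) then 2 else if ((¬ ℓ ∣ W₂.conductorNorm ℤ ∧ ℓ ∣ W₁.conductorNorm ℤ ∧ (¬ ℓ ^ 2 ∣ W₁.conductorNorm ℤ ∨ Odd (W₂.LFunction ℓ))) ∨ (ℓ ∣ W₂.conductorNorm ℤ ∧ ¬ ℓ ^ 2 ∣ W₂.conductorNorm ℤ ∧ ℓ ^ 2 ∣ W₁.conductorNorm ℤ)) then 1 else 0) S hS hSodd hρe₂ hσe₂ hL₂
      hSL hLS F₂ hF₂sym D₂.L.lattice.toAddSubgroup D₂.c (fun z hz ↦ D₂.smul_periodLattice_le z hz) (fun ℓ ↦ if (¬ ℓ ^ 2 ∣ W₁.conductorNorm ℤ ∧ ¬ ℓ ^ 2 ∣ W₂.conductorNorm ℤ) then (1 : ℤ) else 0)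
      (fun ℓ hℓ ↦ by have h := (spec ℓ hℓ).2.1; rwa [zero_mul, add_zero] at h) (fun ℓ hℓ ↦ (spec ℓ hℓ).2.2.1)
      (fun ℓ hℓ ↦ by have h := (spec ℓ hℓ).2.2.2; rwa [zero_add] at h) ht₂ y

/-- **The common eigen-ideal kills the half-periods of both canonical forms** (the last row of `canonicalForms_rows` alone).
[cite: DarmonDiamondTaylor1995, §1.3 and §4.1] [cite: CremonaAlgorithms1997, §2.10] -/
theorem canonicalForms_half_smul_mem_of_mem_span
    (W₁ W₂ : WeierstrassCurve ℚ) [W₁.IsElliptic] [W₁.IsGloballyMinimal] [W₂.IsElliptic] [W₂.IsGloballyMinimal]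
    (hord₁ : IsOrdinaryAt W₁ 2) (hord₂ : IsOrdinaryAt W₂ 2)
    {F : Type*} [Field F] [NumberField F] (hF : Module.finrank ℚ F = 3)
    (ht₁ : ∀ x : ℚ, ¬ HasRationalTwoTorsionX W₁ x) (ht₂ : ∀ x : ℚ, ¬ HasRationalTwoTorsionX W₂ x)
    {e₁ e₂ : F} (he₁ : aeval e₁ (twoDivisionUCubic W₁) = 0) (he₂ : aeval e₂ (twoDivisionUCubic W₂) = 0)
    [NeZero (W₁.conductorNorm ℤ)] [NeZero (W₂.conductorNorm ℤ)]
    (D₁ : ModularParametrizationData W₁ (W₁.conductorNorm ℤ)) (D₂ : ModularParametrizationData W₂ (W₂.conductorNorm ℤ))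
    (L : ℕ) [NeZero L] (hLdef : L = Nat.lcm (W₁.conductorNorm ℤ) (W₂.conductorNorm ℤ))
    (F₁ F₂ : CuspForm (Gamma0 L) 2)
    (hF₁ : ∀ n : ℕ, cuspCoeff F₁ n =
          ((∏ ℓ ∈ (W₁.conductorNorm ℤ * W₂.conductorNorm ℤ).primeFactors.erase 2,
            (MonoidAlgebra.single 1 (1 : ℂ) + MonoidAlgebra.single ℓ ((if ((¬ ℓ ∣ W₁.conductorNorm ℤ ∧ ℓ ∣ W₂.conductorNorm ℤ ∧ (¬ ℓ ^ 2 ∣ W₂.conductorNorm ℤ ∨ Odd (W₁.LFunction ℓ))) ∨ (ℓ ∣ W₁.conductorNorm ℤ ∧ ¬ ℓ ^ 2 ∣ W₁.conductorNorm ℤ ∧ ℓ ^ 2 ∣ W₂.conductorNorm ℤ)) then (1 : ℤ) else 0 : ℤ) : ℂ) +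
              MonoidAlgebra.single (ℓ ^ 2) ((if (¬ ℓ ∣ W₁.conductorNorm ℤ ∧ ℓ ^ 2 ∣ W₂.conductorNorm ℤ) then (1 : ℤ) else 0 : ℤ) : ℂ)) : MonoidAlgebra ℂ ℕ).coeff.sum
            fun m c ↦ c * ((m : ℂ) * if m ∣ n then cuspCoeff D₁.f (n / m) else 0)))
    (hF₂ : ∀ n : ℕ, cuspCoeff F₂ n =
          ((∏ ℓ ∈ (W₁.conductorNorm ℤ * W₂.conductorNorm ℤ).primeFactors.erase 2,
            (MonoidAlgebra.single 1 (1 : ℂ) + MonoidAlgebra.single ℓ ((if ((¬ ℓ ∣ W₂.conductorNorm ℤ ∧ ℓ ∣ W₁.conductorNorm ℤ ∧ (¬ ℓ ^ 2 ∣ W₁.conductorNorm ℤ ∨ Odd (W₂.LFunction ℓ))) ∨ (ℓ ∣ W₂.conductorNorm ℤ ∧ ¬ ℓ ^ 2 ∣ W₂.conductorNorm ℤ ∧ ℓ ^ 2 ∣ W₁.conductorNorm ℤ)) then (1 : ℤ) else 0 : ℤ) : ℂ) +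
              MonoidAlgebra.single (ℓ ^ 2) ((if (¬ ℓ ∣ W₂.conductorNorm ℤ ∧ ℓ ^ 2 ∣ W₁.conductorNorm ℤ) then (1 : ℤ) else 0 : ℤ) : ℂ)) : MonoidAlgebra ℂ ℕ).coeff.sum
            fun m c ↦ c * ((m : ℂ) * if m ∣ n then cuspCoeff D₂.f (n / m) else 0)))
    {t : HeckeRing0 L 2}
    (ht : t ∈ Ideal.span ({t : HeckeRing0 L 2 | t = 2 ∨
      (∃ (p : ℕ) (hp : p.Prime), p ∉ (W₁.conductorNorm ℤ * W₂.conductorNorm ℤ).primeFactors.erase 2 ∧ t = HeckeRing0.T L 2 p hp - (W₁.LFunction p : HeckeRing0 L 2)) ∨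
      (∃ (ℓ : ℕ) (hℓ : ℓ ∈ (W₁.conductorNorm ℤ * W₂.conductorNorm ℤ).primeFactors.erase 2),
        t = HeckeRing0.T L 2 ℓ (Nat.prime_of_mem_primeFactors (Finset.mem_of_mem_erase hℓ)) -
          ((if (¬ ℓ ^ 2 ∣ W₁.conductorNorm ℤ ∧ ¬ ℓ ^ 2 ∣ W₂.conductorNorm ℤ) then (1 : ℤ) else 0 : ℤ) : HeckeRing0 L 2))}))
    (y : periodHomologyHecke L) :
    (D₁.c : ℂ) * ((t • y : periodHomologyHecke L) : Module.Dual ℂ (CuspForm (Gamma0 L) 2)) F₁ / 2 ∈ D₁.L.lattice ∧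
      (D₂.c : ℂ) * ((t • y : periodHomologyHecke L) : Module.Dual ℂ (CuspForm (Gamma0 L) 2)) F₂ / 2 ∈ D₂.L.lattice :=
  (canonicalForms_rows W₁ W₂ hord₁ hord₂ hF ht₁ ht₂ he₁ he₂ D₁ D₂ L hLdef F₁ F₂ hF₁ hF₂).2.2.2.2 t ht y

/-- **THE HECKE ROWS OF THE TWO CANONICAL FORMS IN T1⁺ CURRENCY** — verbatim the hypotheses `hF₁𝔪`, `hF₂𝔪` of att-p4 g18's shape-agnostic consumer
`…KilfordKernelLetterCrossLevelCarrierForms.uniformize_twoForms_ker_iff_of_carrier` (p701652) for `𝔪 = (2, T_p − a_p(W₁) (p prime ∤ N₁N₂), T_ℓ − β_ℓ (ℓ ∈ S))`: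
`Dᵢ.jacobiMapForm L Fᵢ _ [(t•y)/2] = O` for both `i`, every `t ∈ 𝔪` and every cycle `y` (any lattice-compatibility proofs `hgᵢ`; they exist by `canonicalForms_rows`).
[cite: DarmonDiamondTaylor1995, §1.3 and §4.1] [cite: CremonaAlgorithms1997, §2.10] [cite: DiamondShurman2005, Prop. 5.6.2] -/
theorem jacobiMapForm_canonicalForms_half_smul_eq_zero
    (W₁ W₂ : WeierstrassCurve ℚ) [W₁.IsElliptic] [W₁.IsGloballyMinimal] [W₂.IsElliptic] [W₂.IsGloballyMinimal]
    (hord₁ : IsOrdinaryAt W₁ 2) (hord₂ : IsOrdinaryAt W₂ 2)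
    {F : Type*} [Field F] [NumberField F] (hF : Module.finrank ℚ F = 3)
    (ht₁ : ∀ x : ℚ, ¬ HasRationalTwoTorsionX W₁ x) (ht₂ : ∀ x : ℚ, ¬ HasRationalTwoTorsionX W₂ x)
    {e₁ e₂ : F} (he₁ : aeval e₁ (twoDivisionUCubic W₁) = 0) (he₂ : aeval e₂ (twoDivisionUCubic W₂) = 0)
    [NeZero (W₁.conductorNorm ℤ)] [NeZero (W₂.conductorNorm ℤ)]
    (D₁ : ModularParametrizationData W₁ (W₁.conductorNorm ℤ)) (D₂ : ModularParametrizationData W₂ (W₂.conductorNorm ℤ))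
    (L : ℕ) [NeZero L] (hLdef : L = Nat.lcm (W₁.conductorNorm ℤ) (W₂.conductorNorm ℤ))
    (F₁ F₂ : CuspForm (Gamma0 L) 2)
    (hF₁ : ∀ n : ℕ, cuspCoeff F₁ n =
          ((∏ ℓ ∈ (W₁.conductorNorm ℤ * W₂.conductorNorm ℤ).primeFactors.erase 2,
            (MonoidAlgebra.single 1 (1 : ℂ) + MonoidAlgebra.single ℓ ((if ((¬ ℓ ∣ W₁.conductorNorm ℤ ∧ ℓ ∣ W₂.conductorNorm ℤ ∧ (¬ ℓ ^ 2 ∣ W₂.conductorNorm ℤ ∨ Odd (W₁.LFunction ℓ))) ∨ (ℓ ∣ W₁.conductorNorm ℤ ∧ ¬ ℓ ^ 2 ∣ W₁.conductorNorm ℤ ∧ ℓ ^ 2 ∣ W₂.conductorNorm ℤ)) then (1 : ℤ) else 0 : ℤ) : ℂ) +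
              MonoidAlgebra.single (ℓ ^ 2) ((if (¬ ℓ ∣ W₁.conductorNorm ℤ ∧ ℓ ^ 2 ∣ W₂.conductorNorm ℤ) then (1 : ℤ) else 0 : ℤ) : ℂ)) : MonoidAlgebra ℂ ℕ).coeff.sum
            fun m c ↦ c * ((m : ℂ) * if m ∣ n then cuspCoeff D₁.f (n / m) else 0)))
    (hF₂ : ∀ n : ℕ, cuspCoeff F₂ n =
          ((∏ ℓ ∈ (W₁.conductorNorm ℤ * W₂.conductorNorm ℤ).primeFactors.erase 2,
            (MonoidAlgebra.single 1 (1 : ℂ) + MonoidAlgebra.single ℓ ((if ((¬ ℓ ∣ W₂.conductorNorm ℤ ∧ ℓ ∣ W₁.conductorNorm ℤ ∧ (¬ ℓ ^ 2 ∣ W₁.conductorNorm ℤ ∨ Odd (W₂.LFunction ℓ))) ∨ (ℓ ∣ W₂.conductorNorm ℤ ∧ ¬ ℓ ^ 2 ∣ W₂.conductorNorm ℤ ∧ ℓ ^ 2 ∣ W₁.conductorNorm ℤ)) then (1 : ℤ) else 0 : ℤ) : ℂ) +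
              MonoidAlgebra.single (ℓ ^ 2) ((if (¬ ℓ ∣ W₂.conductorNorm ℤ ∧ ℓ ^ 2 ∣ W₁.conductorNorm ℤ) then (1 : ℤ) else 0 : ℤ) : ℂ)) : MonoidAlgebra ℂ ℕ).coeff.sum
            fun m c ↦ c * ((m : ℂ) * if m ∣ n then cuspCoeff D₂.f (n / m) else 0)))
    (hg₁ : ∀ φ ∈ periodHomology L, (D₁.c : ℂ) * φ F₁ ∈ D₁.L.lattice) (hg₂ : ∀ φ ∈ periodHomology L, (D₂.c : ℂ) * φ F₂ ∈ D₂.L.lattice)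
    {t : HeckeRing0 L 2}
    (ht : t ∈ Ideal.span ({t : HeckeRing0 L 2 | t = 2 ∨
      (∃ (p : ℕ) (hp : p.Prime), p ∉ (W₁.conductorNorm ℤ * W₂.conductorNorm ℤ).primeFactors.erase 2 ∧ t = HeckeRing0.T L 2 p hp - (W₁.LFunction p : HeckeRing0 L 2)) ∨
      (∃ (ℓ : ℕ) (hℓ : ℓ ∈ (W₁.conductorNorm ℤ * W₂.conductorNorm ℤ).primeFactors.erase 2),
        t = HeckeRing0.T L 2 ℓ (Nat.prime_of_mem_primeFactors (Finset.mem_of_mem_erase hℓ)) -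
          ((if (¬ ℓ ^ 2 ∣ W₁.conductorNorm ℤ ∧ ¬ ℓ ^ 2 ∣ W₂.conductorNorm ℤ) then (1 : ℤ) else 0 : ℤ) : HeckeRing0 L 2))}))
    (y : periodHomologyHecke L) :
    D₁.jacobiMapForm L F₁ hg₁ (Submodule.Quotient.mk ((2 : ℂ)⁻¹ • ((t • y : periodHomologyHecke L) : Module.Dual ℂ (CuspForm (Gamma0 L) 2)))) = 0 ∧
      D₂.jacobiMapForm L F₂ hg₂ (Submodule.Quotient.mk ((2 : ℂ)⁻¹ • ((t • y : periodHomologyHecke L) : Module.Dual ℂ (CuspForm (Gamma0 L) 2)))) = 0 := by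
  obtain ⟨h₁, h₂⟩ := (canonicalForms_rows W₁ W₂ hord₁ hord₂ hF ht₁ ht₂ he₁ he₂ D₁ D₂ L hLdef F₁ F₂ hF₁ hF₂).2.2.2.2 t ht y
  rw [jacobiMapForm_oldLine_half_eq_zero_iff, D₁.uniformize_eq_zero_iff, jacobiMapForm_oldLine_half_eq_zero_iff, D₂.uniformize_eq_zero_iff]
  exact ⟨h₁, h₂⟩

end Summit.BirchSwinnertonDyer.BirchSwinnertonDyer.Theorems.AlignedTransportAtTwoKilfordCopyCrossLevelFactorHeckeConductor

end
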